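import Summits.RiemannHypothesis.RiemannHypothesis.Theorems.WeilGroundStateMarkovPartPositiveGroundStateMainAux
import Summits.RiemannHypothesis.RiemannHypothesis.Theorems.PfPersistenceEdgeLawDialSpace
import HarnessLib

/-!
# PF persistence (theory 1, edge law): THE MARKOV CORE OF A NON-NEGATIVE WEIGHT TABLE, I —
# the finite-energy class, the core bottom, core ground states, and the pair deficit

Helper file (`--supports stmt-RiemannHypothesis-19953`); mechanism/rigidity campaign; no RH claims.
First of four files (`PfPersistenceMarkovCore{,Rigidity,Positivity,PerronFrobenius}`) proving KERNEL
PERRON–FROBENIUS for the Markov core of EVERY weight table `w : ℕ → ℝ` with `w n ≥ 0` on the prime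
index of the window, at EVERY window `a > 0`, RH-free and operator-free.  Since it holds for every
non-negative table it cannot distinguish ζ's table `zetaTable = Λ(n)/√n` from any other: it closes a
case, it is not an invariant.

## The objects (dictionary with the cell's ledgers)

For a table `w` and a window `[-a, a]` the closed windowed form splits as
`tableClosedForm a w f = weilPoleForm f + coreForm a w f` (`coreForm_eq`): the POLAR term (rank two)
plus the MARKOV CORE `coreForm a w f = 𝓔^w_a(f) − M^w_a ‖f‖²`, whose energy
`𝓔^w_a = tableDirichletEnergy a w` is a killed pure-jump Dirichlet form with jump measure
`ρ(t)dt + Σ_{log n < 2a} w(n) δ_{log n}`, `ρ = weilArchDensity > 0` at every length.  On the unit sphere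
of the window the core and its energy differ by the constant `M^w_a` (`coreForm_of_norm_one`), so the
CORE GROUND STATES of the window are the normalised minimisers of `𝓔^w_a` over the finite-energy class
`coreAdm a` (square integrable, vanishing off `[-a, a]`, finite archimedean energy): `IsCoreGround w a u`,
bottom `coreBottom w a`.

## Results of this file (`∀ n ∈ weilPrimeIndex a, 0 ≤ w n`)

* `tableDirichletEnergy_norm_le` — Beurling–Deny: `𝓔^w_a(|u|) ≤ 𝓔^w_a(u)`;
* `coreBottom_mul_le` — the variational principle `coreBottom · ‖v‖² ≤ 𝓔^w_a(v)` on the class;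
* `table_lintegral_deficit_le` — the pair-deficit inequality: under
  `|M(y) − M(x)|² + F(x,y) = w₀|Φ₀(y) − Φ₀(x)|² + w₁|Φ₁(y) − Φ₁(x)|²`, `F ≥ 0`, the archimedean part of
  `∬ F` is bounded by the energy gap; the prime atoms of a NON-NEGATIVE table only add non-negative
  deficits, which are dropped (the tree's `lintegral_deficit_le`, route WeilGroundState, is the case
  `w = Λ(n)/√n`; the proofs here are that file's, transported verbatim).

## References

* M. Reed, B. Simon, *Methods of Modern Mathematical Physics IV* (1978), §XIII.12, Thms XIII.43–44.
* Z.-Q. Chen, M. Fukushima, *Symmetric Markov Processes, Time Change, and Boundary Theory* (2012),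
  §1.1 Def. 1.1.2, Thm 1.1.3(e) (normal contractions operate on a Dirichlet form).
* E. H. Lieb, M. Loss, *Analysis*, 2nd ed. (2001), Thm 7.8 (convexity of the energy in the density).
* E. Bombieri, Rend. Mat. Acc. Lincei (9) 11 (2000) 183–233, Thm 2 (the windowed explicit formula).
-/

set_option linter.dupNamespace false

noncomputable section

open MeasureTheory Set Filter
open scoped Topology ENNReal NNReal ComplexConjugate

namespace Summit.RiemannHypothesis.RiemannHypothesis.Theorems.PfPersistence

open Literature.NumberTheory.LFunctions
open Summit.RiemannHypothesis.RiemannHypothesis.Theorems.WeilWindowFlowWindowLipschitz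
  (stub_localizedCut_aesm_weilIncrement)
open Summit.RiemannHypothesis.RiemannHypothesis.Theorems.WeilGroundStateMarkovPart
open Summit.RiemannHypothesis.RiemannHypothesis.Theorems.PfPersistenceDownCone (zetaTable)

/-! ## §0 The Markov core of a table: finite-energy class, bottom, ground states -/

/-- The finite-energy class of the window `[-a, a]`: `f ∈ L²`, `f = 0` off `[-a, a]`, finite
archimedean energy `∫₀^∞ ρ(t) D_t(f) dt < ∞` (the form domain of the killed jump form, as in the
tree's route WeilGroundState files). [folklore] -/
def coreAdm (a : ℝ) (f : ℝ → ℂ) : Prop :=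
  MemLp f 2 ∧ (∀ x, x ∉ Icc (-a) a → f x = 0) ∧
    IntegrableOn (fun t ↦ weilArchDensity t * weilIncrement f t) (Ioi 0)

/-- The set of energies `𝓔^w_a(f)` of the normalised members of the finite-energy class. [folklore] -/
def coreSet (w : ℕ → ℝ) (a : ℝ) : Set ℝ :=
  {x | ∃ f : ℝ → ℂ, coreAdm a f ∧ ∫ y, ‖f y‖ ^ 2 = (1 : ℝ) ∧ x = tableDirichletEnergy a w f}

/-- **The bottom of the Markov core of the table `w` on the window `[-a, a]`**: the infimum of the
energy `𝓔^w_a` over the normalised finite-energy class (for ζ's table `= inf Q₀ + M_a` over window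
tests, `coreBottom_zetaTable`). [cite: ReedSimonIV1978, §XIII.12 Thm XIII.44] -/
def coreBottom (w : ℕ → ℝ) (a : ℝ) : ℝ :=
  sInf (coreSet w a)

/-- The Markov core of the closed windowed form of the table `w`: `𝓔^w_a(f) − M^w_a ‖f‖²`. [cite: Bombieri2000Weil, Thm 2 (p. 193)] -/
def coreForm (a : ℝ) (w : ℕ → ℝ) (f : ℝ → ℂ) : ℝ :=
  tableDirichletEnergy a w f - tableMarkovConstant a w * ∫ x, ‖f x‖ ^ 2

/-- **Polar/Markov splitting of the closed form of a table**: `tableClosedForm = weilPoleForm + coreForm`. [cite: Bombieri2000Weil, Thm 2 (p. 193)] -/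
theorem coreForm_eq (a : ℝ) (w : ℕ → ℝ) (f : ℝ → ℂ) :
    tableClosedForm a w f = weilPoleForm f + coreForm a w f := by
  unfold tableClosedForm coreForm
  ring

/-- **Core ground state** of the table `w` on the window `[-a, a]`: a normalised member of the
finite-energy class attaining the bottom of `𝓔^w_a` (equivalently of `coreForm a w`, which differs from
`𝓔^w_a` by the constant `M^w_a` on the unit sphere, `coreForm_of_norm_one`). [cite: ReedSimonIV1978, §XIII.12 Thm XIII.44] -/
def IsCoreGround (w : ℕ → ℝ) (a : ℝ) (u : ℝ → ℂ) : Prop :=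
  coreAdm a u ∧ ∫ x, ‖u x‖ ^ 2 = (1 : ℝ) ∧ tableDirichletEnergy a w u = coreBottom w a

/-- On the unit sphere the core is the energy shifted by the killing constant. [folklore] -/
theorem coreForm_of_norm_one {a : ℝ} {w : ℕ → ℝ} {f : ℝ → ℂ} (hn : ∫ x, ‖f x‖ ^ 2 = (1 : ℝ)) :
    coreForm a w f = tableDirichletEnergy a w f - tableMarkovConstant a w := by
  rw [coreForm, hn, mul_one]

/-! ## §1 Algebra of the table energy -/

/-- `𝓔^w_a ≥ 0` for a non-negative table. [folklore] -/
theorem tableDirichletEnergy_nonneg {a : ℝ} {w : ℕ → ℝ} (hw : ∀ n ∈ weilPrimeIndex a, 0 ≤ w n)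
    (g : ℝ → ℂ) : 0 ≤ tableDirichletEnergy a w g := by
  refine add_nonneg (Finset.sum_nonneg fun n hn ↦ mul_nonneg (hw n hn) (weilIncrement_nonneg g _)) ?_
  exact setIntegral_nonneg measurableSet_Ioi fun t ht ↦
    mul_nonneg (weilArchDensity_pos ht).le (weilIncrement_nonneg g t)

/-- `𝓔^w_a` only sees a.e. classes. [folklore] -/
theorem tableDirichletEnergy_congr_ae (a : ℝ) (w : ℕ → ℝ) {u v : ℝ → ℂ} (h : u =ᵐ[volume] v) :
    tableDirichletEnergy a w u = tableDirichletEnergy a w v := by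
  simp only [tableDirichletEnergy, weilIncrement_congr_ae h]

/-- Homogeneity: `𝓔^w_a(c h) = |c|² 𝓔^w_a(h)`. [folklore] -/
theorem tableDirichletEnergy_const_mul (a : ℝ) (w : ℕ → ℝ) (c : ℂ) (h : ℝ → ℂ) :
    tableDirichletEnergy a w (fun x ↦ c * h x) = ‖c‖ ^ 2 * tableDirichletEnergy a w h := by
  unfold tableDirichletEnergy
  simp only [weilIncrement_const_mul]
  rw [mul_add, Finset.mul_sum, ← integral_const_mul]
  congr 1
  · exact Finset.sum_congr rfl fun n _ ↦ by ring
  · exact integral_congr_ae (Eventually.of_forall fun t ↦ by ring)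

/-- Reflection invariance: `𝓔^w_a(g(−·)) = 𝓔^w_a(g)`. [folklore] -/
theorem tableDirichletEnergy_comp_neg (a : ℝ) (w : ℕ → ℝ) (g : ℝ → ℂ) :
    tableDirichletEnergy a w (fun x ↦ g (-x)) = tableDirichletEnergy a w g := by
  simp only [tableDirichletEnergy, weilIncrement_comp_neg]

/-- **Beurling–Deny for the table energy**: `𝓔^w_a(|u|) ≤ 𝓔^w_a(u)` for `u ∈ L²` of finite
archimedean energy and a non-negative table (the modulus is a normal contraction;
`weilIncrement_norm_le`). [cite: ChenFukushima2012, §1.1 Def. 1.1.2 and Thm. 1.1.3(e)] -/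
theorem tableDirichletEnergy_norm_le {a : ℝ} {w : ℕ → ℝ} (hw : ∀ n ∈ weilPrimeIndex a, 0 ≤ w n)
    {u : ℝ → ℂ} (hu : MemLp u 2)
    (hfin : IntegrableOn (fun t ↦ weilArchDensity t * weilIncrement u t) (Ioi 0)) :
    tableDirichletEnergy a w (fun x ↦ ((‖u x‖ : ℝ) : ℂ)) ≤ tableDirichletEnergy a w u := by
  refine add_le_add (Finset.sum_le_sum fun n hn ↦ mul_le_mul_of_nonneg_left
    (weilIncrement_norm_le hu _) (hw n hn)) ?_
  refine integral_mono_of_nonneg ?_ hfin ?_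
  · exact (ae_restrict_iff' measurableSet_Ioi).2 (Eventually.of_forall fun t ht ↦
      mul_nonneg (weilArchDensity_pos ht).le (weilIncrement_nonneg _ t))
  · exact (ae_restrict_iff' measurableSet_Ioi).2 (Eventually.of_forall fun t ht ↦
      mul_le_mul_of_nonneg_left (weilIncrement_norm_le hu t) (weilArchDensity_pos ht).le)

/-! ## §2 The finite-energy class and the variational principle of the core -/

/-- Window test functions belong to the finite-energy class. [folklore] -/
theorem coreAdm_of_isWeilTest {a : ℝ} {g : ℝ → ℂ} (hg : IsWeilTest g)
    (hgs : tsupport g ⊆ Icc (-a) a) : coreAdm a g :=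
  ⟨hg.memLp_two, fun _ hx ↦ image_eq_zero_of_notMem_tsupport fun h ↦ hx (hgs h),
    integrableOn_weilArchDensity_mul_weilIncrement hg⟩

/-- The class is closed under scalars. [folklore] -/
theorem coreAdm.const_mul {a : ℝ} {f : ℝ → ℂ} (hf : coreAdm a f) (c : ℂ) :
    coreAdm a (fun x ↦ c * f x) := by
  refine ⟨hf.1.const_mul c, fun x hx ↦ by simp only [hf.2.1 x hx, mul_zero], ?_⟩
  have e : (fun t ↦ weilArchDensity t * weilIncrement (fun x ↦ c * f x) t) =
      fun t ↦ ‖c‖ ^ 2 * (weilArchDensity t * weilIncrement f t) := by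
    funext t
    rw [weilIncrement_const_mul]
    ring
  rw [e]
  exact hf.2.2.const_mul _

/-- The class only depends on the a.e. class, given the pointwise support condition. [folklore] -/
theorem coreAdm.congr_ae {a : ℝ} {f g : ℝ → ℂ} (hf : coreAdm a f) (hfg : f =ᵐ[volume] g)
    (hgs : ∀ x, x ∉ Icc (-a) a → g x = 0) : coreAdm a g := by
  refine ⟨hf.1.ae_eq hfg, hgs, ?_⟩
  rw [← weilIncrement_congr_ae hfg]
  exact hf.2.2

/-- The modulus stays in the class. [folklore] -/
theorem coreAdm.norm {a : ℝ} {f : ℝ → ℂ} (hf : coreAdm a f) :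
    coreAdm a (fun x ↦ ((‖f x‖ : ℝ) : ℂ)) :=
  ⟨memLp_ofReal_norm hf.1, fun x hx ↦ by simp [hf.2.1 x hx], finiteEnergy_norm hf.1 hf.2.2⟩

/-- The reflection stays in the class. [folklore] -/
theorem coreAdm.comp_neg {a : ℝ} {f : ℝ → ℂ} (hf : coreAdm a f) : coreAdm a (fun x ↦ f (-x)) := by
  refine ⟨hf.1.comp_measurePreserving (Measure.measurePreserving_neg volume), fun x hx ↦
    hf.2.1 (-x) fun h ↦ hx ⟨by linarith [h.2], by linarith [h.1]⟩, ?_⟩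
  simp only [weilIncrement_comp_neg]
  exact hf.2.2

/-- The energy set of the window is non-empty (`a > 0`: window tests exist). [folklore] -/
theorem coreSet_nonempty (w : ℕ → ℝ) {a : ℝ} (ha : 0 < a) : (coreSet w a).Nonempty := by
  obtain ⟨g, hg, hgs, hn⟩ := exists_isWeilTest_sphere ha
  exact ⟨_, g, coreAdm_of_isWeilTest hg hgs, hn, rfl⟩

/-- The energy set is bounded below by `0` for a non-negative table. [folklore] -/
theorem coreSet_bddBelow {a : ℝ} {w : ℕ → ℝ} (hw : ∀ n ∈ weilPrimeIndex a, 0 ≤ w n) :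
    BddBelow (coreSet w a) := by
  refine ⟨0, ?_⟩
  rintro _ ⟨f, -, -, rfl⟩
  exact tableDirichletEnergy_nonneg hw f

/-- `coreBottom ≥ 0`. [folklore] -/
theorem coreBottom_nonneg {a : ℝ} {w : ℕ → ℝ} (hw : ∀ n ∈ weilPrimeIndex a, 0 ≤ w n)
    (ha : 0 < a) : 0 ≤ coreBottom w a := by
  refine le_csInf (coreSet_nonempty w ha) ?_
  rintro _ ⟨f, -, -, rfl⟩
  exact tableDirichletEnergy_nonneg hw f

/-- The variational principle on the unit sphere of the class. [folklore] -/
theorem coreBottom_le {a : ℝ} {w : ℕ → ℝ} (hw : ∀ n ∈ weilPrimeIndex a, 0 ≤ w n) {f : ℝ → ℂ}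
    (hf : coreAdm a f) (hn : ∫ x, ‖f x‖ ^ 2 = (1 : ℝ)) :
    coreBottom w a ≤ tableDirichletEnergy a w f :=
  csInf_le (coreSet_bddBelow hw) ⟨f, hf, hn, rfl⟩

/-- **The variational principle of the core on the whole finite-energy class**:
`coreBottom · ∫|v|² ≤ 𝓔^w_a(v)` (normalise; `𝓔^w_a ≥ 0` when `∫|v|² = 0`). [cite: ReedSimonIV1978, §XIII.1 (min–max / Rayleigh quotient)] -/
theorem coreBottom_mul_le {a : ℝ} {w : ℕ → ℝ} (hw : ∀ n ∈ weilPrimeIndex a, 0 ≤ w n)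
    {v : ℝ → ℂ} (hv : coreAdm a v) :
    coreBottom w a * ∫ x, ‖v x‖ ^ 2 ≤ tableDirichletEnergy a w v := by
  set N : ℝ := ∫ x, ‖v x‖ ^ 2 with hN
  have hN0 : 0 ≤ N := integral_nonneg fun _ ↦ by positivity
  rcases hN0.eq_or_lt with hz | hpos
  · rw [← hz, mul_zero]
    exact tableDirichletEnergy_nonneg hw v
  set c : ℝ := (Real.sqrt N)⁻¹ with hc
  have hcpos : 0 < c := inv_pos.2 (Real.sqrt_pos.2 hpos)
  set v₁ : ℝ → ℂ := fun x ↦ (c : ℂ) * v x with hv₁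
  have hc2 : ‖(c : ℂ)‖ ^ 2 = N⁻¹ := by
    rw [Complex.norm_real, Real.norm_of_nonneg hcpos.le, hc, inv_pow, Real.sq_sqrt hN0]
  have hn₁ : ∫ x, ‖v₁ x‖ ^ 2 = 1 := by
    have e : (fun x ↦ ‖v₁ x‖ ^ 2) = fun x ↦ ‖(c : ℂ)‖ ^ 2 * ‖v x‖ ^ 2 := by
      funext x
      simp only [hv₁, norm_mul, mul_pow]
    rw [e, integral_const_mul, hc2, ← hN, inv_mul_cancel₀ hpos.ne']
  have hle := coreBottom_le hw (hv.const_mul c) hn₁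
  rw [tableDirichletEnergy_const_mul, hc2] at hle
  calc coreBottom w a * N ≤ N⁻¹ * tableDirichletEnergy a w v * N :=
        mul_le_mul_of_nonneg_right hle hN0
    _ = tableDirichletEnergy a w v := by field_simp

/-! ## §3 The pair deficit of the table energy -/

/-- **The energy deficit for a table.** Under the pointwise identity
`|M(y) − M(x)|² + F(x, y) = w₀|Φ₀(y) − Φ₀(x)|² + w₁|Φ₁(y) − Φ₁(x)|²` with `F ≥ 0`, `M, Φ₀, Φ₁ ∈ L²`
and `Φ₀, Φ₁` of finite archimedean energy: `M` has finite archimedean energy and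
`∫⁻_{t>0} ∫⁻ ofReal(ρ(t) F(x, x+t)) dx dt ≤ ofReal(w₀ 𝓔^w_a(Φ₀) + w₁ 𝓔^w_a(Φ₁) − 𝓔^w_a(M))` — the
prime atoms of a NON-NEGATIVE table only add non-negative deficits `w(n) ∫ F(x, x + log n) dx`,
which are dropped (the tree's `lintegral_deficit_le` is the case `w = Λ(n)/√n`). [cite: LiebLoss2001, Thm 7.8] -/
theorem table_lintegral_deficit_le {a : ℝ} {w : ℕ → ℝ} (hw : ∀ n ∈ weilPrimeIndex a, 0 ≤ w n)
    {M Φ₀ Φ₁ : ℝ → ℂ} {w₀ w₁ : ℝ}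
    (hM : MemLp M 2) (hΦ₀ : MemLp Φ₀ 2) (hΦ₁ : MemLp Φ₁ 2)
    {F : ℝ → ℝ → ℝ} (hF0 : ∀ x y, 0 ≤ F x y)
    (hid : ∀ x y, ‖M y - M x‖ ^ 2 + F x y = w₀ * ‖Φ₀ y - Φ₀ x‖ ^ 2 + w₁ * ‖Φ₁ y - Φ₁ x‖ ^ 2)
    (hfin₀ : IntegrableOn (fun t ↦ weilArchDensity t * weilIncrement Φ₀ t) (Ioi 0))
    (hfin₁ : IntegrableOn (fun t ↦ weilArchDensity t * weilIncrement Φ₁ t) (Ioi 0)) :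
    IntegrableOn (fun t ↦ weilArchDensity t * weilIncrement M t) (Ioi 0) ∧
      ∫⁻ t in Ioi (0 : ℝ), ∫⁻ x, ENNReal.ofReal (weilArchDensity t * F x (x + t)) ≤
        ENNReal.ofReal (w₀ * tableDirichletEnergy a w Φ₀ + w₁ * tableDirichletEnergy a w Φ₁ -
          tableDirichletEnergy a w M) := by
  have hstep := fun t ↦ weilIncrement_add_integral_deficit hM hΦ₀ hΦ₁ hid t
  -- the deficit at length `t`
  set R : ℝ → ℝ := fun t ↦ ∫ x, F x (x + t) with hRdef
  have hR0 : ∀ t, 0 ≤ R t := fun t ↦ integral_nonneg fun x ↦ hF0 _ _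
  have hReq : ∀ t, R t = w₀ * weilIncrement Φ₀ t + w₁ * weilIncrement Φ₁ t - weilIncrement M t :=
    fun t ↦ by have := (hstep t).2; simp only [hRdef]; linarith
  have hD : ∀ t, weilIncrement M t ≤ w₀ * weilIncrement Φ₀ t + w₁ * weilIncrement Φ₁ t :=
    fun t ↦ by linarith [hR0 t, hReq t]
  -- measurability
  have hMm : AEStronglyMeasurable (fun t ↦ weilArchDensity t * weilIncrement M t)
      (volume.restrict (Ioi 0)) :=
    (measurable_weilArchDensity.aestronglyMeasurable.mul
      (stub_localizedCut_aesm_weilIncrement hM.1)).restrict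
  -- finite archimedean energy of `M`
  have hdom : IntegrableOn (fun t ↦ w₀ * (weilArchDensity t * weilIncrement Φ₀ t) +
      w₁ * (weilArchDensity t * weilIncrement Φ₁ t)) (Ioi 0) :=
    (hfin₀.const_mul w₀).add (hfin₁.const_mul w₁)
  have hfinM : IntegrableOn (fun t ↦ weilArchDensity t * weilIncrement M t) (Ioi 0) := by
    refine Integrable.mono' hdom hMm ?_
    refine (ae_restrict_iff' measurableSet_Ioi).2 (Eventually.of_forall fun t (ht : 0 < t) ↦ ?_)
    have hρ := (weilArchDensity_pos ht).le
    rw [Real.norm_of_nonneg (mul_nonneg hρ (weilIncrement_nonneg M t))]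
    have := mul_le_mul_of_nonneg_left (hD t) hρ
    linarith [this]
  refine ⟨hfinM, ?_⟩
  -- the weighted deficit is integrable with integral `≤` the energy gap
  have hρR : IntegrableOn (fun t ↦ weilArchDensity t * R t) (Ioi 0) := by
    have h := hdom.sub hfinM
    refine h.congr (Eventually.of_forall fun t ↦ ?_)
    simp only [Pi.sub_apply, hReq]
    ring
  have hρR_int : ∫ t in Ioi (0 : ℝ), weilArchDensity t * R t =
      w₀ * (∫ t in Ioi (0 : ℝ), weilArchDensity t * weilIncrement Φ₀ t) +
        w₁ * (∫ t in Ioi (0 : ℝ), weilArchDensity t * weilIncrement Φ₁ t) -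
        ∫ t in Ioi (0 : ℝ), weilArchDensity t * weilIncrement M t := by
    rw [← integral_const_mul, ← integral_const_mul, ← integral_add (hfin₀.const_mul w₀)
      (hfin₁.const_mul w₁), ← integral_sub hdom hfinM]
    refine integral_congr_ae (Eventually.of_forall fun t ↦ ?_)
    simp only [hReq]
    ring
  have hprime : (∑ n ∈ weilPrimeIndex a, w n * weilIncrement M (Real.log n)) ≤
      w₀ * (∑ n ∈ weilPrimeIndex a, w n * weilIncrement Φ₀ (Real.log n)) +
        w₁ * (∑ n ∈ weilPrimeIndex a, w n * weilIncrement Φ₁ (Real.log n)) := by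
    rw [Finset.mul_sum, Finset.mul_sum, ← Finset.sum_add_distrib]
    refine Finset.sum_le_sum fun n hn ↦ ?_
    have := mul_le_mul_of_nonneg_left (hD (Real.log n)) (hw n hn)
    linarith [this]
  have hgap : ∫ t in Ioi (0 : ℝ), weilArchDensity t * R t ≤
      w₀ * tableDirichletEnergy a w Φ₀ + w₁ * tableDirichletEnergy a w Φ₁ -
        tableDirichletEnergy a w M := by
    rw [hρR_int]
    unfold tableDirichletEnergy
    linarith [hprime]
  -- convert to lower Lebesgue integrals
  have hinner : ∀ t ∈ Ioi (0 : ℝ), ∫⁻ x, ENNReal.ofReal (weilArchDensity t * F x (x + t)) =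
      ENNReal.ofReal (weilArchDensity t * R t) := by
    intro t ht
    have hρ := (weilArchDensity_pos ht).le
    rw [hRdef]
    simp only
    rw [← integral_const_mul, ofReal_integral_eq_lintegral_ofReal ((hstep t).1.const_mul _)
      (Eventually.of_forall fun x ↦ mul_nonneg hρ (hF0 _ _))]
  rw [setLIntegral_congr_fun measurableSet_Ioi hinner,
    ← ofReal_integral_eq_lintegral_ofReal hρR ((ae_restrict_iff' measurableSet_Ioi).2
      (Eventually.of_forall fun t (ht : 0 < t) ↦
        mul_nonneg (weilArchDensity_pos ht).le (hR0 t)))]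
  exact ENNReal.ofReal_le_ofReal hgap

end Summit.RiemannHypothesis.RiemannHypothesis.Theorems.PfPersistence

end
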